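import Summits.BirchSwinnertonDyer.BirchSwinnertonDyer.Theorems.GenusKolyvaginAtTwoEquivariantKolyvaginExactAtTwoRTOnCut
import Summits.BirchSwinnertonDyer.BirchSwinnertonDyer.Theorems.GenusKolyvaginAtTwoShaCardDvdPowAtTwoRTRootNumberOfMinimalTwin
import HarnessLib

/-!
# Route `GenusKolyvaginAtTwo`, cruxes U_T `ShaCardDvdPowAtTwoRT` (23658) / Q3R_T `EquivariantKolyvaginExactAtTwoRT` (23657), LINE 19 —
# THE CUT THEOREMS WITHOUT THE SIGN HYPOTHESIS: `#Ш(E/K)[2^∞] ∣ 2^(2M₀)` and `= 2^(2M₀)` from `#Sel₂(Wd) = 2`, `ord₂ c(Wd) ≤ 1` alone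

Seat `bsd-line-gk2-p1` g19 (LEAD, cell `bsd-f1-sign2`), `--supports stmt-BirchSwinnertonDyer-23658` (helper; closes nothing).  THEOREMS ONLY.
gk2-p5 g30's (W1) `rootNumber_eq_one_of_natCard_selmerGroup_twin_eq_two_onHabitat` (p750865) derives `w(E) = 1` from the 2-Selmer-minimal twin on
U_T's frame, so the cut of LINE 19 (skeleton v1.3) is «∃ a globally minimal elliptic `Wd ≅ E^{(d_K)}` with `#Sel₂(Wd) = 2 ∧ ord₂ c(Wd) ≤ 1`» and
nothing else.  BSD is NOT proved by any of this; U_T / Q3R_T as filed are NOT proved (off the cut nothing is claimed).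

* `natCard_primaryComponent_sha_two_dvd_pow_onCut_of_selmer` — U_T′ (explicit binders, Q2 only, no `w`).
* `natCard_primaryComponent_sha_two_eq_pow_onCut_of_selmer` — Q3R_T′ (Q3R_T's binders + the three cut hypotheses, no `w`).

References: [McCallumLMS1991] §5; [Kolyvagin1990] Thm. A; [GrossLMS1991] §5 Prop. 5.3; [Kramer1981] Thm. 1.
-/

set_option autoImplicit false
-- the Theorems namespace of this sub repeats the summit name by design (D-0017 nested layout)
set_option linter.dupNamespace false

noncomputable section

open scoped Classical

namespace Summit.BirchSwinnertonDyer.BirchSwinnertonDyer.Theorems.GenusExact.RationalPairDescent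

open WeierstrassCurve NumberField IsDedekindDomain Field Literature.NumberTheory.EllipticCurves
  Literature.NumberTheory.GaloisRepresentations Literature.NumberTheory.EllipticCurves.ModularForms
open Literature.NumberTheory
open Summit.BirchSwinnertonDyer.BirchSwinnertonDyer.Theses.GenusKolyvaginAtTwo
open Summit.BirchSwinnertonDyer.BirchSwinnertonDyer.Theorems
open Summit.BirchSwinnertonDyer.BirchSwinnertonDyer.Theorems.GenusExact.PlusDescent

/-- **U_T ON THE CUT WITHOUT THE SIGN HYPOTHESIS: `#Ш(E/K)[2^∞] ∣ 2^(2M₀)`** on U_T's habitat for every elliptic `ℚ`-model `Wd ≅ E^{(d_K)}`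
with `#Sel₂(Wd) = 2` and `ord₂ c(Wd) ≤ 1` — `w(E) = 1` is DERIVED (gk2-p5 g30's (W1) `rootNumber_eq_one_of_natCard_selmerGroup_twin_eq_two_onHabitat`:
`#Sel₂(Wd) = 2` forces `rank Wd(ℚ) = 1`, hence `w(E) = +1` by Gross 5.3 / parity on the frame), then `natCard_primaryComponent_sha_two_dvd_pow_onCut`.
Only the antecedent Q2; explicit binders.  This is the hw-free statement for the pen's U_T′ (R7-d).  BSD is NOT proved; U_T as filed is NOT proved.
[cite: McCallumLMS1991, §5 Thm. 5.4, Cor. 5.6] [cite: GrossLMS1991, §5 Prop. 5.3] [cite: Kramer1981, Thm. 1] -/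
theorem natCard_primaryComponent_sha_two_dvd_pow_onCut_of_selmer (hQ2 : KolyvaginRelationAtTwo)
    (W : WeierstrassCurve ℚ) [W.IsElliptic] [W.IsGloballyMinimal] [NeZero (W.conductorNorm ℤ)] (hcm : ¬ W.HasCM)
    (hT : Odd W.tamagawaProduct) (v : HeightOneSpectrum (𝓞 ℚ)) (h2v : ((2 : ℕ) : 𝓞 ℚ) ∉ v.asIdeal)
    (hNv : ((W.conductorNorm ℤ : ℕ) : 𝓞 ℚ) ∈ v.asIdeal) (hmult : W.HasMultiplicativeReductionAt v) (hneg : W.Δ < 0)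
    (K : Type) [Field K] [NumberField K] (hIQ : IsImaginaryQuadratic K) (hodd : Odd (NumberField.discr K))
    (h3 : NumberField.discr K ≠ -3) (hHe : SatisfiesHeegnerHypothesis (W.conductorNorm ℤ) K)
    (hsq1 : ¬ IsSquare ((NumberField.discr K : ℚ) * -|W.Δ|)) (hsq2 : ¬ IsSquare ((NumberField.discr K : ℚ) * (-(2 * |W.Δ|))))
    (hρ : ∀ n : ℕ, 0 < n → W.HasSurjectiveModNGaloisRep ((2 : ℤ) ^ n))
    (Dt : ModularParametrizationData W (W.conductorNorm ℤ)) (β : ℤ) (ι : K →+* ℂ) (d₁ : KolyvaginHeegnerData Dt β ι 1)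
    (hy : ¬ IsOfFinAddOrder d₁.derivedPoint) (M₀ : ℕ)
    (hndiv : ¬ ∃ Q : (W.baseChange (ringClassField K ι 1)).toAffine.Point, ((2 ^ (M₀ + 1) : ℕ) : ℤ) • Q = d₁.derivedPoint)
    (Wd : WeierstrassCurve ℚ) [Wd.IsElliptic]
    (hWd : ∃ C : VariableChange ℚ, C • W.quadraticTwist (NumberField.discr K : ℚ) = Wd)
    (hSel : Nat.card (Wd.selmerGroup 2) = 2) (hDEF : padicValNat 2 Wd.tamagawaProduct ≤ 1) :
    Nat.card (AddCommGroup.primaryComponent (W.baseChange K).sha 2) ∣ 2 ^ (2 * M₀) :=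
  natCard_primaryComponent_sha_two_dvd_pow_onCut hQ2 W hcm hT v h2v hNv hmult hneg K hIQ hodd h3 hHe hsq1 hsq2 hρ Dt β ι d₁ hy M₀ hndiv
    (rootNumber_eq_one_of_natCard_selmerGroup_twin_eq_two_onHabitat hQ2 W hcm hT v h2v hNv hmult hneg K hIQ hodd h3 hHe hsq1 hsq2 hρ Dt β ι
      d₁ hy M₀ hndiv Wd hWd hSel)
    Wd hWd hSel hDEF

/-- **KOLYVAGIN'S EXACT FORMULA AT 2 ON THE CUT WITHOUT THE SIGN HYPOTHESIS: `#Ш(E/K)[2^∞] = 2^(2M₀)`** — Q3R_T's binders verbatim with the three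
cut hypotheses (a globally minimal elliptic `Wd ≅ E^{(d_K)}`, `#Sel₂(Wd) = 2`, `ord₂ c(Wd) ≤ 1`) inserted after the `M₀`-clause; `w(E) = 1` derived by
(W1).  `Nat.dvd_antisymm` of the upper half (this file) and the closed L_T (`Theorems.powDvdShaCardAtTwoRT_proof`).  The statement for a restated
Q3R_T′.  Q3R_T / U_T AS FILED are NOT proved; BSD is NOT proved by any of this.
[cite: McCallumLMS1991, §5 Thm. 5.4, Cor. 5.6, Thm. 5.8] [cite: Kolyvagin1990, Thm. A] [cite: GrossLMS1991, §5 Prop. 5.3] -/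
theorem natCard_primaryComponent_sha_two_eq_pow_onCut_of_selmer :
  KolyvaginRelationAtTwo → EquivariantChebotarevAtTwoR → (∀ (W : WeierstrassCurve ℚ) [W.IsElliptic], W.Δ < 0 → ∀ (c₀ : Field.absoluteGaloisGroup ℚ), Literature.NumberTheory.GaloisRepresentations.IsComplexConjugation (Rat.castHom ℝ) c₀ → ∀ (M : ℕ), ∃ P : W.geomTorsion ((2 ^ M : ℕ) : ℤ), ∀ Q : W.geomTorsion ((2 ^ M : ℕ) : ℤ), ∃ a b : ℤ, Q = a • P + b • (c₀ • P)) → ∀ (W : WeierstrassCurve ℚ) [W.IsElliptic] [W.IsGloballyMinimal] [NeZero (W.conductorNorm ℤ)], ¬ W.HasCM → Odd W.tamagawaProduct → ∀ (v : IsDedekindDomain.HeightOneSpectrum (NumberField.RingOfIntegers ℚ)), ((2 : ℕ) : NumberField.RingOfIntegers ℚ) ∉ v.asIdeal → ((W.conductorNorm ℤ : ℕ) : NumberField.RingOfIntegers ℚ) ∈ v.asIdeal → W.HasMultiplicativeReductionAt v → W.Δ < 0 → ∀ (K : Type) [Field K] [NumberField K], Literature.NumberTheory.EllipticCurves.IsImaginaryQuadratic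 K → Odd (NumberField.discr K) → NumberField.discr K ≠ -3 → Literature.NumberTheory.EllipticCurves.SatisfiesHeegnerHypothesis (W.conductorNorm ℤ) K → ¬ IsSquare ((NumberField.discr K : ℚ) * -|W.Δ|) → ¬ IsSquare ((NumberField.discr K : ℚ) * (-(2 * |W.Δ|))) → (∀ n : ℕ, 0 < n → W.HasSurjectiveModNGaloisRep ((2 : ℤ) ^ n)) → ∀ (Dt : Literature.NumberTheory.EllipticCurves.ModularForms.ModularParametrizationData W (W.conductorNorm ℤ)) (β : ℤ) (ι : K →+* ℂ) (d₁ : Literature.NumberTheory.EllipticCurves.KolyvaginHeegnerData Dt β ι 1), ¬ IsOfFinAddOrder d₁.derivedPoint → ∀ (M₀ : ℕ), (∃ Q : (W.baseChange (Literature.NumberTheory.EllipticCurves.ringClassField K ι 1)).toAffine.Point, ((2 ^ M₀ : ℕ) : ℤ) • Q = d₁.derivedPoint) → (¬ ∃ Q : (W.baseChange (Literature.NumberTheory.EllipticCurves.ringClassField K ι 1)).toAffine.Point, ((2 ^ (M₀ + 1) : ℕ) : ℤ) • Q = d₁.derivedPoint) →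
      ∀ (Wd : WeierstrassCurve ℚ) [Wd.IsElliptic] [Wd.IsGloballyMinimal],
        (∃ C : WeierstrassCurve.VariableChange ℚ, C • W.quadraticTwist (NumberField.discr K : ℚ) = Wd) →
        Nat.card (Wd.selmerGroup 2) = 2 → padicValNat 2 Wd.tamagawaProduct ≤ 1 →
      ∀ (n : ℕ) (d : Literature.NumberTheory.EllipticCurves.KolyvaginHeegnerData Dt β ι n), Squarefree n → (∀ ℓ ∈ n.primeFactors, Literature.NumberTheory.EllipticCurves.Zhang2014.IsKolyvaginPrime (W.conductorNorm ℤ) W K 2 ℓ ∧ 2 ≤ Literature.NumberTheory.EllipticCurves.Zhang2014.kolyvaginIndex W 2 ℓ ∧ Literature.NumberTheory.EllipticCurves.FrobEqFrobInfty W K 2 ℓ) → (¬ ∃ Q : (W.baseChange (Literature.NumberTheory.EllipticCurves.ringClassField K ι n)).toAffine.Point, (2 : ℤ) • Q = d.derivedPoint) → Nat.card (AddCommGroup.primaryComponent (W.baseChange K).sha 2) = 2 ^ (2 * M₀) := by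
  intro hQ2 hQ5R hQ1 W _ _ _ hcm hT v h2v hNv hmult hneg K _ _ hIQ hodd h3 hHe hsq1 hsq2 hρ Dt β ι d₁ hy M₀ hdiv hndiv Wd _ _ hWd hSel hDEF
    n d hn hKoly hPn
  have hw : W.rootNumber = 1 :=
    rootNumber_eq_one_of_natCard_selmerGroup_twin_eq_two_onHabitat hQ2 W hcm hT v h2v hNv hmult hneg K hIQ hodd h3 hHe hsq1 hsq2 hρ Dt β ι
      d₁ hy M₀ hndiv Wd hWd hSel
  exact natCard_primaryComponent_sha_two_eq_pow_onCut hQ2 hQ5R hQ1 W hcm hT v h2v hNv hmult hneg K hIQ hodd h3 hHe hsq1 hsq2 hρ Dt β ι d₁ hy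
    M₀ hdiv hndiv hw Wd hWd hSel hDEF n d hn hKoly hPn

end Summit.BirchSwinnertonDyer.BirchSwinnertonDyer.Theorems.GenusExact.RationalPairDescent

end
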